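import Literature.AlgebraicGeometry.Motives.GrassmannianCharts
import Mathlib.Algebra.Exact.Basic
import Mathlib.LinearAlgebra.LinearIndependent.Lemmas
import Mathlib.LinearAlgebra.Dimension.StrongRankCondition
import Mathlib.RingTheory.Finiteness.Cardinality
import Mathlib.RingTheory.Flat.Basic
import HarnessLib

/-!
# The standard charts of the Grassmannian: surjectivity criterion and the pointwise cover over fields

Topic `Literature/AlgebraicGeometry/Motives`; namespace `Literature.AlgebraicGeometry.Motives`, prefix `Grassmannian.`.  Sequel to
`GrassmannianCharts` ((C1)+(C2)); cell hodgecm-mathlib key (h4) (author B-p21 (g15), partner B-p18 (g17)), deliverables (C2′) and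
(C5).  THEOREMS ONLY (no definition, no instance, no notation, no `sorry`).

* **(C2′) `Grassmannian.mem_chart_iff_surjective`** — `N ∈ chart x A` iff the frame map `Aᵏ → (A ⊗ M)⧸N` is SURJECTIVE (a
  surjection `Aᵏ ↠ Q` onto a finite projective module of constant rank `k` splits, `Aᵏ ≅ ker × Q`, and the rank count forces
  `ker = 0`); equivalently (`mem_chart_iff_span_eq_top`) the classes `[1 ⊗ xᵢ]` generate `(A ⊗ M)⧸N`.  This is the form in which
  the chart is the non-vanishing locus of the `x`-minor ([Stacks 089T]: «the map `𝒪ᵏ → Q` is surjective, equivalently an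
  isomorphism»).
* **(C5) `Grassmannian.exists_mem_chart_of_field`** — THE CHARTS COVER POINTWISE: over a field `K`, every `N ∈ G(k, K ⊗ M; K)`
  lies in the chart of some `k`-sub-frame `g ∘ I` (`I : Fin k → J` injective) of any generating family `g : J → M` of `M`
  (the classes `[1 ⊗ g j]` span the `k`-dimensional quotient, so `k` of them form a basis) — the field-valued-points half of
  «the `U_I` form an open cover of the Grassmannian» ([Stacks 089T]; EGA I 9.7.4; [EisenbudHarris2016, §3.2.2]).

HC_CM is proved only modulo the 7 printed citations until rung 0 closes; nothing here is about HC.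

## References
* [StacksProject, Tag 089T]; A. Grothendieck, EGA I (Springer 1971), §9.7.4; [EisenbudHarris2016, §3.2.2].
-/

set_option autoImplicit false

noncomputable section

universe u v w

open TensorProduct

namespace Literature.AlgebraicGeometry.Motives

namespace Grassmannian

variable {R : Type u} [CommRing R] {M : Type v} [AddCommGroup M] [Module R M] {k : ℕ}
variable {A : Type w} [CommRing A] [Algebra R A]

/-! ## §1 (C2′) A surjective frame map is bijective -/

/-- **A surjection `Aᵏ ↠ Q` onto a finite projective `A`-module of constant rank `k` is bijective**: it splits (`Q` projective),
`Aᵏ ≅ ker × Q`, so `ker` is finite projective with `rankAtStalk ker + k = k`, i.e. of rank `0` at every prime, hence zero.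
[cite: StacksProject, Tag 089T] -/
theorem bijective_of_surjective_of_rankAtStalk_eq {Q : Type*} [AddCommGroup Q] [Module A Q] [Module.Finite A Q]
    [Module.Projective A Q] (hQ : ∀ p, Module.rankAtStalk (R := A) Q p = k) (g : (Fin k → A) →ₗ[A] Q)
    (hg : Function.Surjective g) : Function.Bijective g := by
  refine ⟨?_, hg⟩
  -- a section and the splitting `Aᵏ ≃ ker g × Q`
  obtain ⟨l, hl⟩ := Module.projective_lifting_property g LinearMap.id hg
  obtain ⟨E, hE₁, -⟩ := (g.exact_subtype_ker_map.splitSurjectiveEquiv (LinearMap.ker g).subtype_injective) ⟨l, hl⟩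
  -- `ker g` is finite projective
  have hπ : Function.Surjective (LinearMap.fst A (LinearMap.ker g) Q ∘ₗ E.toLinearMap : (Fin k → A) →ₗ[A] LinearMap.ker g) :=
    (LinearMap.fst_surjective (R := A) (M := LinearMap.ker g) (M₂ := Q)).comp E.surjective
  haveI : Module.Finite A (LinearMap.ker g) := Module.Finite.of_surjective _ hπ
  haveI : Module.Projective A (LinearMap.ker g) := by
    refine Module.Projective.of_split (M := Fin k → A) (LinearMap.ker g).subtype
      (LinearMap.fst A (LinearMap.ker g) Q ∘ₗ E.toLinearMap) ?_
    rw [hE₁]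
    refine LinearMap.ext fun v => ?_
    simp only [LinearMap.comp_apply, LinearEquiv.coe_coe, LinearEquiv.apply_symm_apply, LinearMap.inl_apply, LinearMap.fst_apply,
      LinearMap.id_apply]
  -- rank count: `rankAtStalk (ker g) = 0`
  have hK : Module.rankAtStalk (R := A) (LinearMap.ker g) = 0 := by
    funext p
    haveI : Nontrivial A :=
      nontrivial_of_ne 1 0 fun h => (Ideal.ne_top_iff_one _).1 p.2.ne_top (h ▸ p.asIdeal.zero_mem)
    have h := congr_fun ((Module.rankAtStalk_eq_of_equiv E).symm.trans Module.rankAtStalk_eq_finrank_of_free) p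
    rw [Module.rankAtStalk_prod, Pi.add_apply, hQ p, Module.finrank_fin_fun] at h
    simp only [Pi.natCast_apply, Nat.cast_id, Pi.zero_apply] at h ⊢
    omega
  have hsub : Subsingleton (LinearMap.ker g) := Module.rankAtStalk_eq_zero_iff_subsingleton.1 hK
  rw [← LinearMap.ker_eq_bot]
  exact (Submodule.subsingleton_iff_eq_bot).1 hsub

/-- **(C2′) `N ∈ chart x A ↔` the frame map `Aᵏ → (A ⊗ M)⧸N` is surjective** (the quotient is finite projective of constant
rank `k`, so a surjective frame map is bijective). [cite: StacksProject, Tag 089T] [cite: EisenbudHarris2016, §3.2.2] -/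
theorem mem_chart_iff_surjective (x : Fin k → M) (N : Module.Grassmannian A (A ⊗[R] M) k) :
    N ∈ chart R M k x A ↔ Function.Surjective (frameMap x N.toSubmodule) :=
  ⟨fun h => h.2, fun h => bijective_of_surjective_of_rankAtStalk_eq N.rankAtStalk_eq _ h⟩

/-- The range of the frame map is the span of the classes `[1 ⊗ xᵢ]`. [cite: StacksProject, Tag 089T] -/
theorem range_frameMap (x : Fin k → M) (N : Submodule A (A ⊗[R] M)) :
    LinearMap.range (frameMap x N) = Submodule.span A (Set.range fun i => N.mkQ ((1 : A) ⊗ₜ[R] x i)) := by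
  rw [frameMap, Fintype.range_linearCombination]

/-- **(C2′), span form: `N ∈ chart x A ↔` the classes `[1 ⊗ xᵢ]` generate `(A ⊗ M)⧸N`.** [cite: StacksProject, Tag 089T] -/
theorem mem_chart_iff_span_eq_top (x : Fin k → M) (N : Module.Grassmannian A (A ⊗[R] M) k) :
    N ∈ chart R M k x A ↔ Submodule.span A (Set.range fun i => N.toSubmodule.mkQ ((1 : A) ⊗ₜ[R] x i)) = ⊤ := by
  rw [mem_chart_iff_surjective, ← range_frameMap, LinearMap.range_eq_top]

/-! ## §2 (C5) Over a field the charts of the sub-frames of a generating family cover -/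

/-- The classes `[1 ⊗ g j]` of a generating family `g` of `M` generate `(A ⊗ M)⧸N` over `A`. [cite: StacksProject, Tag 089T] -/
theorem span_range_mkQ_tmul_eq_top {J : Type*} (g : J → M) (hg : Submodule.span R (Set.range g) = ⊤)
    (N : Submodule A (A ⊗[R] M)) :
    Submodule.span A (Set.range fun j => N.mkQ ((1 : A) ⊗ₜ[R] g j)) = ⊤ := by
  have h1 : Submodule.span A (Set.range fun j => (1 : A) ⊗ₜ[R] g j) = ⊤ := by
    have h := Submodule.baseChange_span (R := R) (M := M) A (Set.range g)
    rw [hg, Submodule.baseChange_top, ← Set.range_comp] at h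
    exact h.symm
  rw [Set.range_comp' N.mkQ, ← Submodule.map_span, h1, Submodule.map_top, Submodule.range_mkQ]

/-- Over a field, the quotient by a point of `G(k, V; K)` has dimension `k`. [cite: StacksProject, Tag 089R] -/
theorem finrank_quotient_eq_of_field {K : Type w} [Field K] {V : Type*} [AddCommGroup V] [Module K V]
    (N : Module.Grassmannian K V k) : Module.finrank K (V ⧸ N.toSubmodule) = k := by
  have h := congr_fun (Module.rankAtStalk_eq_finrank_of_free (R := K) (M := V ⧸ N.toSubmodule)) ⟨⊥, Ideal.isPrime_bot⟩
  rw [N.rankAtStalk_eq] at h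
  simpa only [Pi.natCast_apply, Nat.cast_id] using h.symm

/-- **(C5) THE STANDARD CHARTS COVER THE GRASSMANNIAN POINTWISE**: over a field `K`, every `N ∈ G(k, K ⊗ M; K)` lies in the
chart of a `k`-sub-frame `g ∘ I` (`I` injective) of any generating family `g : J → M` of `M` — the classes `[1 ⊗ g j]` span the
`k`-dimensional `K`-vector space `(K ⊗ M)⧸N`, so `k` of them form a basis, and then the frame map of `g ∘ I` is surjective, hence
bijective by (C2′).  (Field-valued points of «`⋃_I U_I = Grass`».) [cite: StacksProject, Tag 089T] [cite: EisenbudHarris2016, §3.2.2] -/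
theorem exists_mem_chart_of_field {K : Type w} [Field K] [Algebra R K] {J : Type*} (g : J → M)
    (hg : Submodule.span R (Set.range g) = ⊤) (N : Module.Grassmannian K (K ⊗[R] M) k) :
    ∃ I : Fin k → J, Function.Injective I ∧ N ∈ chart R M k (g ∘ I) K := by
  classical
  -- the spanning family of classes and a linearly independent spanning subfamily
  set q : J → (K ⊗[R] M) ⧸ N.toSubmodule := fun j => N.toSubmodule.mkQ ((1 : K) ⊗ₜ[R] g j) with hq
  have hspan : Submodule.span K (Set.range q) = ⊤ := span_range_mkQ_tmul_eq_top g hg N.toSubmodule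
  obtain ⟨κ, a, ha, hsp, hli⟩ := exists_linearIndependent' K q
  rw [hspan] at hsp
  -- it is a basis, hence indexed by a type of cardinality `k`
  let b : Module.Basis κ K ((K ⊗[R] M) ⧸ N.toSubmodule) := Module.Basis.mk hli (le_of_eq hsp.symm)
  haveI : Finite κ := Module.Finite.finite_basis b
  letI : Fintype κ := Fintype.ofFinite κ
  have hcard : Fintype.card κ = k := by rw [← Module.finrank_eq_card_basis b, finrank_quotient_eq_of_field]
  let e : Fin k ≃ κ := (Fintype.equivFinOfCardEq hcard).symm
  refine ⟨a ∘ e, ha.comp e.injective, ?_⟩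
  -- the frame map of `g ∘ a ∘ e` is surjective: its range is the span of the basis
  rw [mem_chart_iff_span_eq_top]
  have hr : (Set.range fun i => N.toSubmodule.mkQ ((1 : K) ⊗ₜ[R] (g ∘ (a ∘ e)) i)) = Set.range (q ∘ a) := by
    rw [show (fun i => N.toSubmodule.mkQ ((1 : K) ⊗ₜ[R] (g ∘ (a ∘ e)) i)) = (q ∘ a) ∘ e from rfl, EquivLike.range_comp]
  rw [hr, hsp]

/-- (C5) for the tautological generating family `id : M → M`: every field-valued point lies in the chart of SOME frame
`x : Fin k → M`. [cite: StacksProject, Tag 089T] -/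
theorem exists_frame_mem_chart_of_field {K : Type w} [Field K] [Algebra R K] (N : Module.Grassmannian K (K ⊗[R] M) k) :
    ∃ x : Fin k → M, N ∈ chart R M k x K := by
  obtain ⟨I, -, hI⟩ := exists_mem_chart_of_field (R := R) (M := M) (id : M → M) (by rw [Set.range_id, Submodule.span_univ]) N
  exact ⟨id ∘ I, hI⟩

end Grassmannian

end Literature.AlgebraicGeometry.Motives

end
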